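import Literature.Computability.Complexity.OracleSimulateFP
import Literature.Computability.Complexity.MapAnswers
import Literature.Computability.Cryptography.OracleGames
import HarnessLib

/-!
# Emulating an adversary of a game with a RANDOMISED (indexed) oracle: tagging queries with their number

Topic `Literature/Computability/Cryptography` (toolkit, on top of `Complexity/OracleSimulateFP.lean`,
`OracleQueryMap.lean`, `MapAnswers.lean`, `OraclePrefixPost.lean` and the indexed runner `OracleAlg.runIdx` of
`OracleGames.lean`). In the chosen-message experiment the signing oracle tosses fresh coins per query, so a
reduction that emulates the forger and answers its queries itself must give the `i`-th query the `i`-th block of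
its own coins (`SignaturesManyAnswers.lean`): the answering RULE is a function of the query NUMBER. The emulation
brick `OracleAlg.simFn` answers a query `q` of the emulated machine by a fixed `FP` rule `ans ⟨w, q⟩`; this file
makes the query number (and, for the final output, the whole transcript) available to such rules:

* `OracleAlg.keepIdx` — the query rewriting `⟨x, ⟨listBool as, q⟩⟩ ↦ ⟨1^{|as|}, q⟩` (`FP`); against a plain
  oracle `O`, `M.mapQuery keepIdx` runs exactly as `M` against the INDEXED oracle `idxOracle O i q = O ⟨1ⁱ, q⟩`
  (`runAux_mapQuery_keepIdx`, `queriesAux_mapQuery_keepIdx`, the tagged transcript `tagFrom`);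
* `OracleAlg.mapAnswers` against a plain oracle: `runAux_mapAnswers`, `queriesAux_mapAnswers` (reading the
  answers through `f` is running against `f ∘ O`);
* `OracleAlg.postOutS M h` — string-output twin of `postOut`: an output `w` after the answers `as` becomes
  `h ⟨x, ⟨listBool as, w⟩⟩` (so the final rule sees the transcript, e.g. the echoed queries); `runAux_postOutS`,
  `isPolyTime_postOutS`;
* the clocked transcript `queriesAux_clock_eq` (the clock at `q(|x|)` asks exactly the queries of the first
  `q(|x|)` rounds) and the clocked run in the two cases;
* **`OracleAlg.simM M e q d f h`** `= postOutS ((((M.mapQuery keepIdx).mapAnswers f).mapOut e).clock q d) h` and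
  its two theorems: `isPolyTime_simM`, and **`run_simM`** — against every plain oracle `O`, within `q(|x|) + 1`
  rounds it outputs `h ⟨x, ⟨listBool (answers), w⟩⟩` where the answers are `O ⟨1ⁱ, qᵢ⟩` on the queries `qᵢ` of
  `M` run against the indexed oracle `(i, q) ↦ f (O ⟨1ⁱ, q⟩)` for `q(|x|)` rounds, and `w` is `e` of its output
  (or the default `d` on a time-out).

All proved; no named facts.

## References

* S. Arora, B. Barak, *Computational Complexity: A Modern Approach*, CUP 2009, §3.4 (oracle machines; the
  configuration after `i` answers is determined by the input and the answers), §1.4.1 (clocks).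
* O. Goldreich, *Foundations of Cryptography II*, CUP 2004, §6.1.3 (the signing oracle tosses fresh coins per
  query), proofs of Prop. 6.4.15 / 6.4.17 (the reduction emulates the forger answering its queries itself).
-/

namespace Literature.Computability.Complexity

open _root_.Computability Polynomial Brick

namespace OracleAlg

variable {β : Type}

/-! ### Tagging queries with the number of answers received -/

/-- The query rewriting `⟨x, ⟨⟨hdr, body⟩, q⟩⟩ ↦ ⟨hdr, q⟩`: on the step record of `mapQuery`, `hdr = 1^{|as|}` is the
header of the coded transcript, so the query travels with its NUMBER. [Arora–Barak 2009, §3.4] [folklore] -/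
noncomputable def keepIdx : List Bool → List Bool := fanoutFn (fstF ∘ nthF 1) (sndPow 1)

/-- `keepIdx` on a step record. [folklore] -/
theorem keepIdx_apply (x q : List Bool) (as : List (List Bool)) :
    keepIdx (boolPair x (boolPair ((encodingList Bool).listBool.encode as) q)) = boolPair (unaryEncodeNat as.length) q := by
  simp [keepIdx, nthF, sndPow, Encoding.listBool]

/-- `keepIdx ∈ FP`. [folklore] -/
theorem keepIdx_mem_FP : keepIdx ∈ FP := fanoutFn_mem_FP (comp_mem_FP fstF_mem_FP (nthF_mem_FP 1)) (sndPow_mem_FP 1)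

/-- The indexed oracle read through the tags: `(i, q) ↦ O ⟨1ⁱ, q⟩`. [folklore] -/
def idxOracle (O : Oracle) : ℕ → List Bool → List Bool := fun i q => O (boolPair (unaryEncodeNat i) q)

/-- **`M.mapQuery keepIdx` against `O` runs as `M` against the indexed oracle `idxOracle O`.**
[Arora–Barak 2009, §3.4] [folklore] -/
theorem runAux_mapQuery_keepIdx (M : OracleAlg β) (O : Oracle) (x : List Bool) :
    ∀ (k : ℕ) (as : List (List Bool)), (M.mapQuery keepIdx).runAux O x k as = M.runIdxAux (idxOracle O) x k as
  | 0, _ => rfl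
  | k + 1, as => by
    rw [runAux_succ, mapQuery_step, runIdxAux]
    cases M.step x as with
    | inr b => rfl
    | inl q =>
      dsimp only
      rw [keepIdx_apply, runAux_mapQuery_keepIdx M O x k]
      rfl

/-- The queries `qᵢ, q_{i+1}, …` tagged with their numbers: `⟨1ⁱ, qᵢ⟩, ⟨1^{i+1}, q_{i+1}⟩, …`. [folklore] -/
def tagFrom : ℕ → List (List Bool) → List (List Bool)
  | _, [] => []
  | i, q :: qs => boolPair (unaryEncodeNat i) q :: tagFrom (i + 1) qs

/-- `tagFrom` preserves length. [folklore] -/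
@[simp] theorem length_tagFrom : ∀ (i : ℕ) (qs : List (List Bool)), (tagFrom i qs).length = qs.length
  | _, [] => rfl
  | i, q :: qs => by rw [tagFrom, List.length_cons, length_tagFrom (i + 1) qs, List.length_cons]

/-- Entries of `tagFrom`. [folklore] -/
theorem getElem_tagFrom : ∀ (i : ℕ) (qs : List (List Bool)) (j : ℕ) (hj : j < (tagFrom i qs).length),
    (tagFrom i qs)[j] = boolPair (unaryEncodeNat (i + j)) (qs[j]'(by simpa using hj))
  | _, [], j, hj => by simp at hj
  | i, q :: qs, 0, _ => by simp [tagFrom]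
  | i, q :: qs, j + 1, hj => by
    simp only [tagFrom, List.getElem_cons_succ]
    rw [getElem_tagFrom (i + 1) qs j]
    congr 2; omega

/-- Untagging. [folklore] -/
theorem map_sndF_tagFrom : ∀ (i : ℕ) (qs : List (List Bool)), (tagFrom i qs).map sndF = qs
  | _, [] => rfl
  | i, q :: qs => by rw [tagFrom, List.map_cons, sndF_boolPair, map_sndF_tagFrom (i + 1) qs]

/-- **The transcript of `M.mapQuery keepIdx`** is the tagged indexed transcript of `M`. [folklore] -/
theorem queriesAux_mapQuery_keepIdx (M : OracleAlg β) (O : Oracle) (x : List Bool) :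
    ∀ (k : ℕ) (as : List (List Bool)),
      (M.mapQuery keepIdx).queriesAux O x k as = tagFrom as.length (M.queriesIdxAux (idxOracle O) x k as)
  | 0, _ => rfl
  | k + 1, as => by
    rw [queriesIdxAux]
    unfold queriesAux
    rw [mapQuery_step]
    cases M.step x as with
    | inr b => rfl
    | inl q =>
      dsimp only
      rw [keepIdx_apply, tagFrom, queriesAux_mapQuery_keepIdx M O x k, List.length_append, List.length_singleton]
      rfl

/-! ### Reading the answers through a map, against a plain oracle -/

/-- **`M.mapAnswers f` against `O` runs as `M` against `f ∘ O`** (transcript continued from `as.map f`). [folklore] -/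
theorem runAux_mapAnswers (M : OracleAlg β) (f : List Bool → List Bool) (O : Oracle) (x : List Bool) :
    ∀ (k : ℕ) (as : List (List Bool)), (M.mapAnswers f).runAux O x k as = M.runAux (f ∘ O) x k (as.map f)
  | 0, _ => rfl
  | k + 1, as => by
    rw [runAux_succ, runAux_succ, mapAnswers_step]
    cases M.step x (as.map f) with
    | inr b => rfl
    | inl q => dsimp only; rw [runAux_mapAnswers M f O x k, List.map_append, List.map_singleton]; rfl

/-- The queries of `M.mapAnswers f` against `O` are those of `M` against `f ∘ O`. [folklore] -/
theorem queriesAux_mapAnswers (M : OracleAlg β) (f : List Bool → List Bool) (O : Oracle) (x : List Bool) :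
    ∀ (k : ℕ) (as : List (List Bool)), (M.mapAnswers f).queriesAux O x k as = M.queriesAux (f ∘ O) x k (as.map f)
  | 0, _ => rfl
  | k + 1, as => by
    unfold queriesAux
    rw [mapAnswers_step]
    cases M.step x (as.map f) with
    | inr b => rfl
    | inl q => dsimp only; rw [queriesAux_mapAnswers M f O x k, List.map_append, List.map_singleton]; rfl

/-! ### Post-processing a string output with the transcript in hand -/

/-- **`M.postOutS h`**: queries of `M` unchanged; an output `w` of `M` after answers `as` on input `x` becomes the
string `h ⟨x, ⟨listBool as, w⟩⟩` (string-output twin of `postOut`). [Arora–Barak 2009, §3.4] [folklore] -/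
def postOutS (M : OracleAlg (List Bool)) (h : List Bool → List Bool) : OracleAlg (List Bool) where
  step x as :=
    match M.step x as with
    | Sum.inl q => Sum.inl q
    | Sum.inr w => Sum.inr (h (boolPair x (boolPair ((encodingList Bool).listBool.encode as) w)))

/-- The step of `M.postOutS h` (definitional). [folklore] -/
theorem postOutS_step (M : OracleAlg (List Bool)) (h : List Bool → List Bool) (x : List Bool) (as : List (List Bool)) :
    (M.postOutS h).step x as =
      match M.step x as with
      | Sum.inl q => Sum.inl q
      | Sum.inr w => Sum.inr (h (boolPair x (boolPair ((encodingList Bool).listBool.encode as) w))) :=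
  rfl

/-- **`postOutS` from a run of `M`**: if `M.runAux O x k pre = some w` then `M.postOutS h` outputs the string computed
from the final transcript, and asks the same queries. [Arora–Barak 2009, §3.4] [folklore] -/
theorem runAux_postOutS (M : OracleAlg (List Bool)) (h : List Bool → List Bool) (O : Oracle) (x : List Bool) (k : ℕ)
    (pre : List (List Bool)) (w : List Bool) (hrun : M.runAux O x k pre = some w) :
    (M.postOutS h).runAux O x k pre =
        some (h (boolPair x (boolPair ((encodingList Bool).listBool.encode (pre ++ (M.queriesAux O x k pre).map O)) w))) ∧
      (M.postOutS h).queriesAux O x k pre = M.queriesAux O x k pre := by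
  obtain ⟨us, hlen, hstep, hout, hus⟩ := M.exists_trace_of_runAux O x k pre w hrun
  rw [hus]
  exact (M.postOutS h).runAux_of_trace O x us pre _ k (fun i hi => by rw [postOutS_step, hstep i hi])
    (by rw [postOutS_step, hout]) hlen

section PolyTime

open QueryMapPoly PrePost EmptySim

/-- Stage C of `postOutS` (typed). [folklore] -/
def stPS (h : List Bool → List Bool) (r : (List Bool ⊕ List Bool) × (List Bool × List (List Bool))) : List Bool ⊕ List Bool :=
  match r.1 with
  | Sum.inl y => Sum.inl y
  | Sum.inr w => Sum.inr (h (boolPair r.2.1 (boolPair ((encodingList Bool).listBool.encode r.2.2) w)))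

/-- The step of `M.postOutS h` factors through the stages. [folklore] -/
theorem uncurry_postOutS_step (M : OracleAlg (List Bool)) (h : List Bool → List Bool) :
    Function.uncurry (M.postOutS h).step = stPS h ∘ Prod.map (Function.uncurry M.step) id ∘ fun p : St => (p, p) := by
  funext p
  obtain ⟨x, as⟩ := p
  simp only [Function.uncurry_apply_pair, Function.comp_apply, stPS, Prod.map_apply, id, postOutS_step]

/-- Stage C as a string map on `⟨tag :: payload, ⟨x, LB as⟩⟩`: keep a query, replace an output `payload` by
`1 (h ⟨x, ⟨LB as, payload⟩⟩)`. [folklore] -/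
noncomputable def GPS (h : List Bool → List Bool) : List (Option Bool) → List Bool :=
  iteFn (headT.eval ∘ fun z => (boolUnpair z).1)
    (List.cons true ∘ h ∘ fanoutFn (fun z => (boolUnpair (boolUnpair z).2).1)
      (fanoutFn (fun z => (boolUnpair (boolUnpair z).2).2) (tailT.eval ∘ fun z => (boolUnpair z).1)))
    (fun z => (boolUnpair z).1) ∘
  fromField.eval

/-- **Stage C is polynomial-time** for `h ∈ FP`. [Arora–Barak 2009, §1.3] [folklore] -/
theorem polyTime_stPS {h : List Bool → List Bool} (hh : h ∈ FP) :
    PolyTimeComputable (encQ (encodingList Bool)) ((encodingList Bool).sumBool (encodingList Bool)).encode (stPS h) := by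
  have hfst : (fun z : List Bool => (boolUnpair z).1) ∈ FP := boolUnpairFst_mem_FP
  have hsnd : (fun z : List Bool => (boolUnpair z).2) ∈ FP := boolUnpairSnd_mem_FP
  have hW : (iteFn (headT.eval ∘ fun z => (boolUnpair z).1)
      (List.cons true ∘ h ∘ fanoutFn (fun z => (boolUnpair (boolUnpair z).2).1)
        (fanoutFn (fun z => (boolUnpair (boolUnpair z).2).2) (tailT.eval ∘ fun z => (boolUnpair z).1)))
      (fun z => (boolUnpair z).1)) ∈ FP :=
    iteFn_mem_FP (comp_mem_FP headT.polyTimeComputable_eval hfst)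
      (comp_mem_FP (cons_mem_FP true) (comp_mem_FP hh (fanoutFn_mem_FP (comp_mem_FP hfst hsnd)
        (fanoutFn_mem_FP (comp_mem_FP hsnd hsnd) (comp_mem_FP tailT.polyTimeComputable_eval hfst))))) hfst
  have hS : PolyTimeComputable (id : List (Option Bool) → _) (id : List Bool → List Bool) (GPS h) :=
    PolyTimeComputable.comp_holds hW fromField.polyTimeComputable_eval
  refine PolyTimeComputable.of_encode hS (encQ (encodingList Bool)) (fun _ => rfl) fun q => ?_
  obtain ⟨r, x, as⟩ := q
  have hin : encIn (x, as) = boolPair x ((encodingList Bool).listBool.encode as) := rfl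
  simp only [id, GPS, Function.comp_apply, encQ, fromField_eval, hin]
  have hid : ∀ w : List Bool, (encodingList Bool).encode w = w := fun _ => rfl
  cases r with
  | inl y =>
    rw [iteFn_apply_false]
    · simp [stPS, Encoding.sumBool, hid]
    · simp [headT_eval_cons, Encoding.sumBool, hid]
  | inr b =>
    rw [iteFn_apply_true]
    · simp [stPS, tailT_eval_cons, Encoding.sumBool, hid]
    · simp [headT_eval_cons, Encoding.sumBool, hid]

/-- **`M.postOutS h` is polynomial-time** for `M` polynomial-time and `h ∈ FP`. [Arora–Barak 2009, §3.4 with §1.3]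
[cite: AroraBarak2009, §3.4] -/
theorem isPolyTime_postOutS {M : OracleAlg (List Bool)} (hM : M.IsPolyTime (encodingList Bool)) {h : List Bool → List Bool}
    (hh : h ∈ FP) : (M.postOutS h).IsPolyTime (encodingList Bool) := by
  unfold IsPolyTime
  rw [uncurry_postOutS_step]
  exact PolyTimeComputable.comp_holds (polyTime_stPS hh)
    (PolyTimeComputable.comp_holds (polyTime_stB (encodingList Bool) hM) polyTime_stageA)

end PolyTime

/-! ### The clock: exact transcript and the run in the two cases -/

/-- **The clocked transcript**: with a total budget beyond the clock, `M.clock q b₀` asks exactly the queries `M` asks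
in the rounds the clock allows. [Arora–Barak 2009, §3.4 with §1.4.1] [folklore] -/
theorem queriesAux_clock_eq (M : OracleAlg β) (q : Polynomial ℕ) (b₀ : β) (O : Oracle) (x : List Bool) :
    ∀ (m n : ℕ) (as : List (List Bool)), as.length + m = q.eval x.length → m < n →
      (M.clock q b₀).queriesAux O x n as = M.queriesAux O x m as
  | m, 0, as, _, hn => by omega
  | 0, n + 1, as, h, _ => by
    unfold queriesAux
    rw [clock_step, if_neg (by omega)]
  | m + 1, n + 1, as, h, hn => by
    unfold queriesAux
    rw [clock_step, if_pos (by omega)]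
    cases M.step x as with
    | inr b => rfl
    | inl y =>
      dsimp only
      rw [queriesAux_clock_eq M q b₀ O x m n _ (by simp; omega) (by omega)]

/-- **The clocked run on a time-out**: if `M` does not output within the clock, `M.clock q b₀` outputs `b₀`.
[Arora–Barak 2009, §3.4 with §1.4.1] [folklore] -/
theorem runAux_clock_of_none (M : OracleAlg β) (q : Polynomial ℕ) (b₀ : β) (O : Oracle) (x : List Bool) :
    ∀ (m n : ℕ) (as : List (List Bool)), as.length + m = q.eval x.length → m < n →
      M.runAux O x m as = none → (M.clock q b₀).runAux O x n as = some b₀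
  | m, 0, as, _, hn, _ => by omega
  | 0, n + 1, as, h, _, _ => by
    rw [runAux_succ, clock_step, if_neg (by omega)]
  | m + 1, n + 1, as, h, hn, hr => by
    rw [runAux_succ, clock_step, if_pos (by omega)]
    rw [runAux_succ] at hr
    cases hs : M.step x as with
    | inr b => rw [hs] at hr; simp at hr
    | inl y =>
      rw [hs] at hr
      exact runAux_clock_of_none M q b₀ O x m n _ (by simp; omega) (by omega) hr

/-- The clocked run from the empty transcript, both cases: `M`'s output within `q(|x|)` rounds if any, else `b₀`.
[Arora–Barak 2009, §3.4 with §1.4.1] [folklore] -/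
theorem run_clock_eq (M : OracleAlg β) (q : Polynomial ℕ) (b₀ : β) (O : Oracle) (x : List Bool) {n : ℕ}
    (hn : q.eval x.length < n) :
    (M.clock q b₀).run O n x = some ((M.run O (q.eval x.length) x).getD b₀) := by
  cases hr : M.run O (q.eval x.length) x with
  | some b => rw [run_clock_of_run M q b₀ O x hr hn.le]; rfl
  | none => exact runAux_clock_of_none M q b₀ O x _ n [] (by simp) hn hr

/-- The clocked transcript from the empty transcript. [folklore] -/
theorem queries_clock_eq (M : OracleAlg β) (q : Polynomial ℕ) (b₀ : β) (O : Oracle) (x : List Bool) {n : ℕ}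
    (hn : q.eval x.length < n) : (M.clock q b₀).queries O n x = M.queries O (q.eval x.length) x :=
  queriesAux_clock_eq M q b₀ O x _ n [] (by simp) hn

/-! ### The emulated game adversary -/

/-- **The emulated adversary of a game with an indexed oracle**: outputs re-presented as strings by `e`, clocked at
`q` rounds (default `d`), answers read through `f` (what the adversary sees of an answer record), queries tagged
with their number, and the final output post-processed with the whole transcript by `h`.
[Goldreich 2004, proofs of Prop. 6.4.15 / 6.4.17 (emulating the forger); Arora–Barak 2009, §3.4] [folklore] -/
noncomputable def simM (M : OracleAlg β) (e : β → List Bool) (q : Polynomial ℕ) (d : List Bool) (f h : List Bool → List Bool) :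
    OracleAlg (List Bool) :=
  postOutS ((((M.mapQuery keepIdx).mapAnswers f).mapOut e).clock q d) h

/-- **`simM` is polynomial-time** for `M` polynomial-time (outputs coded by `eb`, `e` realising the same codes), a
non-lengthening `f ∈ FP` and `h ∈ FP`. [Arora–Barak 2009, §3.4 with §1.3] [cite: AroraBarak2009, §3.4] -/
theorem isPolyTime_simM {eb : Encoding β Bool} {M : OracleAlg β} (hM : M.IsPolyTime eb) {e : β → List Bool}
    (he : ∀ b, e b = eb.encode b) (q : Polynomial ℕ) (d : List Bool) {f h : List Bool → List Bool} (hf : f ∈ FP)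
    (hfl : ∀ a, (f a).length ≤ a.length) (hh : h ∈ FP) : (simM M e q d f h).IsPolyTime (encodingList Bool) :=
  isPolyTime_postOutS (isPolyTime_clock (encodingList Bool)
    (IsPolyTime.mapOut (isPolyTime_mapAnswers (isPolyTime_mapQuery eb hM keepIdx_mem_FP) hf hfl) e he) q d) hh

/-- The answer records of a tagged transcript. [folklore] -/
def answersOf (O : Oracle) (qs : List (List Bool)) : List (List Bool) := (tagFrom 0 qs).map O

/-- **The run of `simM`**: against every plain oracle `O`, within `q(|x|) + 1` rounds, `simM M e q d f h` outputs
`h ⟨x, ⟨listBool (answer records), w⟩⟩`, where the answer records are `O ⟨1ⁱ, qᵢ⟩` on the queries `qᵢ` of `M` run for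
`q(|x|)` rounds against the indexed oracle `(i, q) ↦ f (O ⟨1ⁱ, q⟩)`, and `w` is `e` of `M`'s output in that run, or `d`
if there is none. [Goldreich 2004, proofs of Prop. 6.4.15 / 6.4.17; Arora–Barak 2009, §3.4] [folklore] -/
theorem run_simM (M : OracleAlg β) (e : β → List Bool) (q : Polynomial ℕ) (d : List Bool) (f h : List Bool → List Bool)
    (O : Oracle) (x : List Bool) {n : ℕ} (hn : q.eval x.length < n) :
    (simM M e q d f h).run O n x = some (h (boolPair x (boolPair
      ((encodingList Bool).listBool.encode (answersOf O (M.queriesIdx (idxOracle (f ∘ O)) (q.eval x.length) x)))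
      (((M.runIdx (idxOracle (f ∘ O)) (q.eval x.length) x).map e).getD d)))) ∧
    (simM M e q d f h).queries O n x = tagFrom 0 (M.queriesIdx (idxOracle (f ∘ O)) (q.eval x.length) x) := by
  set N := ((M.mapQuery keepIdx).mapAnswers f).mapOut e with hN
  have hNrun : N.run O (q.eval x.length) x = (M.runIdx (idxOracle (f ∘ O)) (q.eval x.length) x).map e := by
    rw [hN, run, runAux_mapOut, runAux_mapAnswers, List.map_nil, runAux_mapQuery_keepIdx]; rfl
  have hNq : N.queries O (q.eval x.length) x = tagFrom 0 (M.queriesIdx (idxOracle (f ∘ O)) (q.eval x.length) x) := by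
    rw [hN, queries, queriesAux_mapOut, queriesAux_mapAnswers, List.map_nil, queriesAux_mapQuery_keepIdx]; rfl
  have hC : (N.clock q d).run O n x = some (((M.runIdx (idxOracle (f ∘ O)) (q.eval x.length) x).map e).getD d) := by
    rw [run_clock_eq N q d O x hn, hNrun]
  have hCq : (N.clock q d).queries O n x = tagFrom 0 (M.queriesIdx (idxOracle (f ∘ O)) (q.eval x.length) x) := by
    rw [queries_clock_eq N q d O x hn, hNq]
  have h := runAux_postOutS (N.clock q d) h O x n [] _ hC
  rw [List.nil_append] at h
  refine ⟨?_, ?_⟩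
  · rw [simM, ← hN, run, h.1]
    unfold queries at hCq
    rw [hCq]
    rfl
  · rw [simM, ← hN, queries, h.2]
    exact hCq

/-- Untagging the queries of `simM`. [folklore] -/
theorem map_sndF_queries_simM (M : OracleAlg β) (e : β → List Bool) (q : Polynomial ℕ) (d : List Bool) (f h : List Bool → List Bool)
    (O : Oracle) (x : List Bool) {n : ℕ} (hn : q.eval x.length < n) :
    ((simM M e q d f h).queries O n x).map sndF = M.queriesIdx (idxOracle (f ∘ O)) (q.eval x.length) x := by
  rw [(run_simM M e q d f h O x hn).2, map_sndF_tagFrom]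

end OracleAlg

end Literature.Computability.Complexity
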